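import Literature.Analysis.FluidPDE.ElgindiL2Coercivity
import Mathlib.Analysis.SpecialFunctions.ImproperIntegrals
import Mathlib.MeasureTheory.Integral.IntegralEqImproper
import Mathlib.Analysis.SpecialFunctions.Pow.Asymptotics
import HarnessLib

/-!
# The Hardy inequality behind Lemma 7.10 of Elgindi: the radial averaging operator `T_p`
([Elgindi2021] §7.5 Lemma 7.10)

Topic `Literature/Analysis/FluidPDE`. Proof file (everything proved, no definitions, no named
facts) on the proof path of the named fact
`Literature.Analysis.FluidPDE.Elgindi.ElgindiGhoulMasmoudi2021_stabilityCore`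
(`ElgindiStabilityDecomposition.lean`). T. M. Elgindi, Ann. of Math. 194 (2021) =
arXiv:1904.04795, §7.5 (p. 24 of the held text):

> "Next, observe that while `Ḡ` is preceded by `1/α`, we still have a good bound for it.
> `|Ḡ|_{L²} ≤ C|F|_{L²}` with `C` a constant independent of `α`. This is a consequence of the
> following Hardy-type inequality established in Lemma A.7 of [EJDG]: **Lemma 7.10.** Let `α > 0`.
> For all `f ∈ 𝓗²([0,∞))` we have `|sin(2θ)R^{−5/α}∫₀^R ρ^{(5−α)/α}f(ρ)dρ|_{𝓗²} ≤ 100α|f|_{𝓗²}`."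

Here `Ḡ = −(3/(4α))R^{−3/α}∫₀^R ρ^{(3−α)/α}F⋆(ρ)dρ` (same page), so the lemma is used with the
exponent `3/α` as well as `5/α`. Both are instances of the radial averaging operator
`T_p f(R) = R^{−p}∫₀^R ρ^{p−1}f(ρ)dρ` (`p = q/α`), and the content of the lemma is the weighted
Hardy inequality for `T_p` with the power weights `R^c`, `c ∈ [−4, 0]`, making up
`w² = (1+R)⁴/R⁴ = Σ C(4,m)R^{−m}`: this file proves, for `f` continuous and supported in `[a, b]`,
`a > 0`, and `p > (c+1)/2`,

  `∫₀^∞ R^c (T_pf)² dR ≤ (2/(2p − c − 1))² ∫₀^∞ R^c f² dR`     (`integral_rpow_mul_sq_radialAvg_le`)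

(for `p = q/α` the constant is `(2α/(2q − α(c+1)))² = O(α²)`), together with the commutation
`D_R(T_pf) = f − pT_pf = T_p(D_Rf)` (`Dz₁_radialAvg`, `radialAvg_Dz₁`) which carries the inequality to
the radial derivatives of the `𝓗ᵏ` norm. (The `𝓗ᵏ` packaging with the factor `sin 2θ` is done where it
is used.)
-/

noncomputable section

open MeasureTheory Set Real Filter intervalIntegral
open _root_.Topology

namespace Literature.Analysis.FluidPDE

namespace Elgindi

/-! ### The primitive `M(R) = ∫₀^R ρ^{p−1}f` and the averaging operator -/

section radialAvg

variable {f : ℝ → ℝ} (hf : Continuous f) {a b : ℝ} (ha : 0 < a) (hfa : ∀ R < a, f R = 0)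
  (hfb : ∀ R, b < R → f R = 0) (p : ℝ)

/-- The integrand `ρ^{p−1}f(ρ)` is continuous (it vanishes near `ρ ≤ 0`). [folklore] -/
theorem continuous_rpow_mul (hf : Continuous f) (ha : 0 < a) (hfa : ∀ R < a, f R = 0) :
    Continuous fun ρ : ℝ => ρ ^ (p - 1) * f ρ :=
  continuous_mul_of_eq_zero_lt (u := fun ρ : ℝ => ρ ^ (p - 1))
    (fun ρ hρ => (Real.continuousAt_rpow_const ρ (p - 1) (Or.inl hρ)).continuousWithinAt) hf ha hfa

include hf ha hfa

/-- `M(R) = ∫₀^R ρ^{p−1}f` has derivative `R^{p−1}f(R)` everywhere. [folklore] -/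
theorem hasDerivAt_radialPrim (R : ℝ) :
    HasDerivAt (fun R => ∫ ρ in (0:ℝ)..R, ρ ^ (p - 1) * f ρ) (R ^ (p - 1) * f R) R :=
  intervalIntegral.integral_hasDerivAt_right ((continuous_rpow_mul p hf ha hfa).intervalIntegrable _ _)
    (continuous_rpow_mul p hf ha hfa).aestronglyMeasurable.stronglyMeasurableAtFilter
    (continuous_rpow_mul p hf ha hfa).continuousAt

omit hf in
/-- `M ≡ 0` below `a`. [folklore] -/
theorem radialPrim_eq_zero_of_lt {R : ℝ} (hR : R < a) : (∫ ρ in (0:ℝ)..R, ρ ^ (p - 1) * f ρ) = 0 := by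
  refine intervalIntegral.integral_zero_ae (Filter.Eventually.of_forall fun ρ hρ => ?_)
  rcases le_or_gt 0 R with h0 | h0
  · rw [uIoc_of_le h0] at hρ; simp [hfa ρ (hρ.2.trans_lt hR)]
  · rw [uIoc_of_ge h0.le] at hρ; simp [hfa ρ (hρ.2.trans_lt ha)]

include hfb in
/-- `M` is constant beyond `b`: `M(R) = M(b')` for `b ≤ b' ≤ R`. [folklore] -/
theorem radialPrim_eq_of_le {R b' : ℝ} (hb' : b ≤ b') (hR : b' ≤ R) :
    (∫ ρ in (0:ℝ)..R, ρ ^ (p - 1) * f ρ) = ∫ ρ in (0:ℝ)..b', ρ ^ (p - 1) * f ρ := by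
  have hc := continuous_rpow_mul p hf ha hfa
  rw [← intervalIntegral.integral_add_adjacent_intervals (hc.intervalIntegrable 0 b') (hc.intervalIntegrable b' R)]
  have : (∫ ρ in b'..R, ρ ^ (p - 1) * f ρ) = 0 := by
    refine intervalIntegral.integral_zero_ae (Filter.Eventually.of_forall fun ρ hρ => ?_)
    rw [uIoc_of_le hR] at hρ
    simp [hfb ρ (hb'.trans_lt hρ.1)]
  rw [this, add_zero]

/-- `M` is continuous. [folklore] -/
theorem continuous_radialPrim : Continuous fun R => ∫ ρ in (0:ℝ)..R, ρ ^ (p - 1) * f ρ :=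
  continuous_iff_continuousAt.2 fun R => (hasDerivAt_radialPrim hf ha hfa p R).continuousAt

end radialAvg

/-! ### The weighted Hardy inequality for `T_p` -/

/-- Pointwise Young with rpow weights on `R > 0`: `2R^{c−p}Mf ≤ εR^{c−2p}M² + ε⁻¹R^cf²`. [folklore] -/
theorem two_mul_rpow_mul_le {R c p ε M f : ℝ} (hR : 0 < R) (hε : 0 < ε) :
    2 * (R ^ (c - p) * M * f) ≤ ε * (R ^ (c - 2 * p) * M ^ 2) + ε⁻¹ * (R ^ c * f ^ 2) := by
  have e1 : R ^ (c - p) = R ^ ((c - 2 * p) / 2) * R ^ (c / 2) := by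
    rw [← Real.rpow_add hR]; congr 1; ring
  have e2 : R ^ (c - 2 * p) = (R ^ ((c - 2 * p) / 2)) ^ 2 := by
    rw [← Real.rpow_natCast, ← Real.rpow_mul hR.le]; congr 1; push_cast; ring
  have e3 : R ^ c = (R ^ (c / 2)) ^ 2 := by
    rw [← Real.rpow_natCast, ← Real.rpow_mul hR.le]; congr 1; push_cast; ring
  rw [e1, e2, e3]
  set x := R ^ ((c - 2 * p) / 2) * M
  set y := R ^ (c / 2) * f
  have key : 2 * (x * y) ≤ ε * x ^ 2 + ε⁻¹ * y ^ 2 := by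
    have h := sq_nonneg (ε * x - y)
    have hε' : ε⁻¹ * (ε * x - y) ^ 2 = ε * x ^ 2 - 2 * (x * y) + ε⁻¹ * y ^ 2 := by field_simp; ring
    nlinarith [mul_nonneg (inv_nonneg.2 hε.le) h, hε']
  calc 2 * (R ^ ((c - 2 * p) / 2) * R ^ (c / 2) * M * f) = 2 * (x * y) := by simp only [x, y]; ring
    _ ≤ ε * x ^ 2 + ε⁻¹ * y ^ 2 := key
    _ = _ := by simp only [x, y]; ring

set_option maxHeartbeats 800000 in
/-- **The weighted Hardy inequality for the radial averaging operator** (the content of Lemma 7.10):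
for `f` continuous, supported in `[a, b]` with `a > 0`, and `p > (c+1)/2`,
`∫₀^∞ R^c (R^{−p}∫₀^R ρ^{p−1}f)² dR ≤ (2/(2p − c − 1))² ∫₀^∞ R^c f² dR`.
[cite: Elgindi2021, §7.5 Lemma 7.10 (p. 24 of arXiv:1904.04795), "= Lemma A.7 of [EJDG]"] -/
theorem integral_rpow_mul_sq_radialAvg_le {f : ℝ → ℝ} (hf : Continuous f) {a b : ℝ} (ha : 0 < a) (hab : a ≤ b)
    (hfa : ∀ R < a, f R = 0) (hfb : ∀ R, b < R → f R = 0) {p c : ℝ} (hp : (c + 1) / 2 < p) :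
    (∫ R in Ioi 0, R ^ c * (R ^ (-p) * ∫ ρ in (0:ℝ)..R, ρ ^ (p - 1) * f ρ) ^ 2) ≤
      (2 / (2 * p - c - 1)) ^ 2 * ∫ R in Ioi 0, R ^ c * f R ^ 2 := by
  -- notation
  set M : ℝ → ℝ := fun R => ∫ ρ in (0:ℝ)..R, ρ ^ (p - 1) * f ρ with hM
  have hMd : ∀ R, HasDerivAt M (R ^ (p - 1) * f R) R := hasDerivAt_radialPrim hf ha hfa p
  have hMc : Continuous M := continuous_radialPrim hf ha hfa p
  have hM0 : ∀ R < a, M R = 0 := fun R hR => radialPrim_eq_zero_of_lt ha hfa p hR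
  have hMb : ∀ R, b ≤ R → M R = M b := fun R hR => radialPrim_eq_of_le hf ha hfa hfb p le_rfl hR
  have hκ : 0 < 2 * p - c - 1 := by linarith
  -- the integrands
  have eX : ∀ R ∈ Ioi (0:ℝ), R ^ c * (R ^ (-p) * M R) ^ 2 = R ^ (c - 2 * p) * M R ^ 2 := by
    intro R hR
    have hR : (0:ℝ) < R := hR
    rw [mul_pow, ← Real.rpow_natCast (R ^ (-p)), ← Real.rpow_mul hR.le, ← mul_assoc, ← Real.rpow_add hR]
    congr 1; congr 1; push_cast; ring
  -- continuity on `(0, ∞)` of the pieces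
  have cpow : ∀ e : ℝ, ContinuousOn (fun R : ℝ => R ^ e) (Ioi 0) := fun e R hR =>
    (Real.continuousAt_rpow_const R e (Or.inl (ne_of_gt hR))).continuousWithinAt
  ----------------------------------------------------------------
  -- integrability on `(0, ∞)`
  ----------------------------------------------------------------
  -- `R^{c−2p} M²`: zero on `(0,a)`, continuous, and `M(b)²R^{c−2p}` beyond `b`
  have iX : IntegrableOn (fun R => R ^ (c - 2 * p) * M R ^ 2) (Ioi 0) := by
    have h1 : IntegrableOn (fun R => R ^ (c - 2 * p) * M R ^ 2) (Ioc 0 b) := by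
      -- bounded by `sup |M|² · a'` … use: on `Ioc 0 b` the function equals the continuous function
      -- `R ↦ φ(R)` where `φ` is the product with `M` vanishing near `0`
      have hc : Continuous fun R => R ^ (c - 2 * p) * M R ^ 2 :=
        continuous_mul_of_eq_zero_lt (u := fun R : ℝ => R ^ (c - 2 * p))
          (fun R hR => (Real.continuousAt_rpow_const R _ (Or.inl hR)).continuousWithinAt) (hMc.pow 2) ha
          fun R hR => by simp [hM0 R hR]
      exact (hc.continuousOn.integrableOn_Icc (a := 0) (b := b)).mono_set Ioc_subset_Icc_self
    have h2 : IntegrableOn (fun R => R ^ (c - 2 * p) * M R ^ 2) (Ioi b) := by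
      have hb0 : 0 < b := ha.trans_le hab
      have hi : IntegrableOn (fun R : ℝ => R ^ (c - 2 * p) * M b ^ 2) (Ioi b) :=
        (integrableOn_Ioi_rpow_of_lt (show c - 2 * p < -1 by linarith) hb0).mul_const (M b ^ 2)
      refine hi.congr_fun (fun R hR => ?_) measurableSet_Ioi
      show R ^ (c - 2 * p) * M b ^ 2 = R ^ (c - 2 * p) * M R ^ 2
      rw [hMb R (le_of_lt hR)]
    have hu : Ioi (0:ℝ) = Ioc 0 b ∪ Ioi b := (Ioc_union_Ioi_eq_Ioi (ha.trans_le hab).le).symm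
    rw [hu]; exact h1.union h2
  -- `R^{c−p} M f` and `R^c f²`: compactly supported in `[a, b]`, continuous
  have cY : Continuous fun R => R ^ (c - p) * M R * f R := by
    have := continuous_mul_of_eq_zero_lt (u := fun R : ℝ => R ^ (c - p)) (M := fun R => M R * f R)
      (fun R hR => (Real.continuousAt_rpow_const R _ (Or.inl hR)).continuousWithinAt) (by fun_prop) ha
      fun R hR => by simp [hfa R hR]
    exact this.congr fun R => by ring
  have cF : Continuous fun R => R ^ c * f R ^ 2 :=
    continuous_mul_of_eq_zero_lt (u := fun R : ℝ => R ^ c)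
      (fun R hR => (Real.continuousAt_rpow_const R _ (Or.inl hR)).continuousWithinAt) (hf.pow 2) ha
      fun R hR => by simp [hfa R hR]
  have suppf : ∀ {g : ℝ → ℝ}, (∀ R, f R = 0 → g R = 0) → HasCompactSupport g := fun {g} hg =>
    HasCompactSupport.of_support_subset_isCompact (isCompact_Icc (a := a) (b := b)) fun R hR => by
      by_contra h
      simp only [mem_Icc, not_and_or, not_le] at h
      rcases h with h | h
      · exact hR (hg R (hfa R h))
      · exact hR (hg R (hfb R h))
  have iY : Integrable fun R => R ^ (c - p) * M R * f R := cY.integrable_of_hasCompactSupport (suppf fun R h => by simp [h])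
  have iF : Integrable fun R => R ^ c * f R ^ 2 := cF.integrable_of_hasCompactSupport (suppf fun R h => by simp [h])
  ----------------------------------------------------------------
  -- the integration by parts: `(2p − c − 1)∫ R^{c−2p}M² = 2∫ R^{c−p} M f`
  ----------------------------------------------------------------
  have hIBP : (2 * p - c - 1) * (∫ R in Ioi 0, R ^ (c - 2 * p) * M R ^ 2) = 2 * ∫ R in Ioi 0, R ^ (c - p) * M R * f R := by
    -- Φ(R) = R^{c−2p+1} M(R)²
    have hΦd : ∀ R ∈ Ioi (0:ℝ), HasDerivAt (fun R => R ^ (c - 2 * p + 1) * M R ^ 2)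
        ((c - 2 * p + 1) * (R ^ (c - 2 * p) * M R ^ 2) + 2 * (R ^ (c - p) * M R * f R)) R := by
      intro R hR
      have hR : (0:ℝ) < R := hR
      have h1 : HasDerivAt (fun R : ℝ => R ^ (c - 2 * p + 1)) ((c - 2 * p + 1) * R ^ (c - 2 * p + 1 - 1)) R :=
        Real.hasDerivAt_rpow_const (Or.inl hR.ne')
      have h2 : HasDerivAt (fun R => M R ^ 2) (2 * M R * (R ^ (p - 1) * f R)) R := by
        have := (hMd R).fun_pow 2
        simpa using this
      refine (h1.fun_mul h2).congr_deriv ?_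
      have e1 : R ^ (c - 2 * p + 1 - 1) = R ^ (c - 2 * p) := by congr 1; ring
      have e2 : R ^ (c - 2 * p + 1) * R ^ (p - 1) = R ^ (c - p) := by rw [← Real.rpow_add hR]; congr 1; ring
      rw [e1]
      calc (c - 2 * p + 1) * R ^ (c - 2 * p) * M R ^ 2 + R ^ (c - 2 * p + 1) * (2 * M R * (R ^ (p - 1) * f R))
          = (c - 2 * p + 1) * (R ^ (c - 2 * p) * M R ^ 2) + 2 * ((R ^ (c - 2 * p + 1) * R ^ (p - 1)) * M R * f R) := by ring
        _ = _ := by rw [e2]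
    have hcont : ContinuousWithinAt (fun R => R ^ (c - 2 * p + 1) * M R ^ 2) (Ici 0) 0 := by
      have h0 : (fun R => R ^ (c - 2 * p + 1) * M R ^ 2) =ᶠ[𝓝 (0:ℝ)] fun _ => 0 :=
        Filter.eventuallyEq_of_mem (Iio_mem_nhds ha) fun R hR => by simp [hM0 R hR]
      have : ContinuousAt (fun R => R ^ (c - 2 * p + 1) * M R ^ 2) 0 := by
        refine (continuousAt_const.congr (f := fun _ => (0:ℝ)) h0.symm)
      exact this.continuousWithinAt
    have hlim : Tendsto (fun R => R ^ (c - 2 * p + 1) * M R ^ 2) atTop (𝓝 0) := by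
      have h1 : Tendsto (fun R : ℝ => R ^ (c - 2 * p + 1)) atTop (𝓝 0) := by
        have := tendsto_rpow_neg_atTop (y := -(c - 2 * p + 1)) (by linarith)
        simpa using this
      have h2 : Tendsto (fun R => M R ^ 2) atTop (𝓝 (M b ^ 2)) := by
        refine tendsto_const_nhds.congr' ?_
        exact Filter.eventuallyEq_of_mem (Ici_mem_atTop b) fun R hR => by simp [hMb R hR]
      simpa using h1.mul h2
    have hint : IntegrableOn (fun R => (c - 2 * p + 1) * (R ^ (c - 2 * p) * M R ^ 2) + 2 * (R ^ (c - p) * M R * f R)) (Ioi 0) :=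
      (iX.const_mul _).add (iY.const_mul _).integrableOn
    have key := integral_Ioi_of_hasDerivAt_of_tendsto hcont hΦd hint hlim
    have eΦ0 : (0:ℝ) ^ (c - 2 * p + 1) * M 0 ^ 2 = 0 := by simp [hM0 0 ha]
    rw [eΦ0, sub_zero, integral_add (iX.const_mul _) (iY.const_mul _).integrableOn, MeasureTheory.integral_const_mul,
      MeasureTheory.integral_const_mul] at key
    linarith
  ----------------------------------------------------------------
  -- Young and conclusion
  ----------------------------------------------------------------
  set ε : ℝ := (2 * p - c - 1) / 2 with hε
  have hε0 : 0 < ε := by rw [hε]; linarith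
  have hY : 2 * (∫ R in Ioi 0, R ^ (c - p) * M R * f R) ≤
      ε * (∫ R in Ioi 0, R ^ (c - 2 * p) * M R ^ 2) + ε⁻¹ * ∫ R in Ioi 0, R ^ c * f R ^ 2 := by
    rw [← MeasureTheory.integral_const_mul, ← MeasureTheory.integral_const_mul, ← MeasureTheory.integral_const_mul,
      ← integral_add (iX.const_mul _) (iF.const_mul _).integrableOn]
    refine setIntegral_mono_on (iY.const_mul _).integrableOn ((iX.const_mul _).add (iF.const_mul _).integrableOn)
      measurableSet_Ioi fun R hR => ?_
    exact two_mul_rpow_mul_le hR hε0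
  have nnX : 0 ≤ ∫ R in Ioi 0, R ^ (c - 2 * p) * M R ^ 2 :=
    setIntegral_nonneg measurableSet_Ioi fun R hR => mul_nonneg (Real.rpow_nonneg (le_of_lt hR) _) (sq_nonneg _)
  have nnF : 0 ≤ ∫ R in Ioi 0, R ^ c * f R ^ 2 :=
    setIntegral_nonneg measurableSet_Ioi fun R hR => mul_nonneg (Real.rpow_nonneg (le_of_lt hR) _) (sq_nonneg _)
  -- `(2p−c−1) X = 2Y ≤ ε X + ε⁻¹ F`, `ε = (2p−c−1)/2` ⇒ `X ≤ (2/(2p−c−1))² F`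
  have hXF : (∫ R in Ioi 0, R ^ (c - 2 * p) * M R ^ 2) ≤ (2 / (2 * p - c - 1)) ^ 2 * ∫ R in Ioi 0, R ^ c * f R ^ 2 := by
    have h1 : (2 * p - c - 1) * (∫ R in Ioi 0, R ^ (c - 2 * p) * M R ^ 2) ≤
        ε * (∫ R in Ioi 0, R ^ (c - 2 * p) * M R ^ 2) + ε⁻¹ * ∫ R in Ioi 0, R ^ c * f R ^ 2 := by rw [hIBP]; exact hY
    have eε : ε⁻¹ = 2 / (2 * p - c - 1) := by rw [hε]; field_simp
    rw [eε, hε] at h1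
    have h2 : (2 * p - c - 1) / 2 * (∫ R in Ioi 0, R ^ (c - 2 * p) * M R ^ 2) ≤ 2 / (2 * p - c - 1) * ∫ R in Ioi 0, R ^ c * f R ^ 2 := by
      linarith
    have h3 := mul_le_mul_of_nonneg_left h2 (show 0 ≤ 2 / (2 * p - c - 1) by positivity)
    have e4 : 2 / (2 * p - c - 1) * ((2 * p - c - 1) / 2 * ∫ R in Ioi 0, R ^ (c - 2 * p) * M R ^ 2) =
        ∫ R in Ioi 0, R ^ (c - 2 * p) * M R ^ 2 := by field_simp
    rw [e4] at h3
    calc _ ≤ _ := h3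
      _ = _ := by ring
  rw [setIntegral_congr_fun measurableSet_Ioi eX]
  exact hXF

/-! ### `D_R` commutes with `T_p` -/

/-- **`D_R(T_pf) = f − pT_pf` on `R > 0`.** [folklore] -/
theorem Dz₁_radialAvg {f : ℝ → ℝ} (hf : Continuous f) {a : ℝ} (ha : 0 < a) (hfa : ∀ R < a, f R = 0) (p : ℝ)
    {R : ℝ} (hR : 0 < R) :
    Dz₁ (fun R => R ^ (-p) * ∫ ρ in (0:ℝ)..R, ρ ^ (p - 1) * f ρ) R =
      f R - p * (R ^ (-p) * ∫ ρ in (0:ℝ)..R, ρ ^ (p - 1) * f ρ) := by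
  have hM := hasDerivAt_radialPrim hf ha hfa p R
  have h1 : HasDerivAt (fun R : ℝ => R ^ (-p)) (-p * R ^ (-p - 1)) R := Real.hasDerivAt_rpow_const (Or.inl hR.ne')
  have h := h1.fun_mul hM
  rw [Dz₁_apply, h.deriv]
  have e1 : R * (R ^ (-p - 1)) = R ^ (-p) := by
    rw [show R * R ^ (-p - 1) = R ^ (1:ℝ) * R ^ (-p - 1) by rw [Real.rpow_one], ← Real.rpow_add hR]; congr 1; ring
  have e2 : R * (R ^ (-p) * R ^ (p - 1)) = 1 := by
    rw [← Real.rpow_add hR, show -p + (p - 1) = -1 by ring, Real.rpow_neg_one, mul_inv_cancel₀ hR.ne']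
  calc R * (-p * R ^ (-p - 1) * (∫ ρ in (0:ℝ)..R, ρ ^ (p - 1) * f ρ) + R ^ (-p) * (R ^ (p - 1) * f R))
      = -p * (R * R ^ (-p - 1)) * (∫ ρ in (0:ℝ)..R, ρ ^ (p - 1) * f ρ) + (R * (R ^ (-p) * R ^ (p - 1))) * f R := by ring
    _ = _ := by rw [e1, e2]; ring

/-- **`T_p(D_Rf) = f − pT_pf` on `R > 0`** for `f ∈ C¹` (integration by parts in `ρ`; with
`Dz₁_radialAvg`: `D_R T_p = T_p D_R`). [folklore] -/
theorem radialAvg_Dz₁ {f : ℝ → ℝ} (hf : ContDiff ℝ 1 f) {a : ℝ} (ha : 0 < a) (hfa : ∀ R < a, f R = 0) {p : ℝ} (hp : 0 < p)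
    {R : ℝ} (hR : 0 < R) :
    R ^ (-p) * (∫ ρ in (0:ℝ)..R, ρ ^ (p - 1) * Dz₁ f ρ) = f R - p * (R ^ (-p) * ∫ ρ in (0:ℝ)..R, ρ ^ (p - 1) * f ρ) := by
  have hfd : ∀ x, HasDerivAt f (deriv f x) x := fun x => (hf.differentiable (by simp) x).hasDerivAt
  have hfc' : Continuous (deriv f) := hf.continuous_deriv le_rfl
  have hfa' : ∀ ρ < a, deriv f ρ = 0 := fun ρ hρ => by
    have h0 : f =ᶠ[𝓝 ρ] fun _ => 0 := Filter.eventuallyEq_of_mem (Iio_mem_nhds hρ) fun x hx => hfa x hx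
    rw [h0.deriv_eq, deriv_const]
  -- `∫₀^R ρ^{p-1} ρ f' = [ρ^p f]₀^R − p ∫₀^R ρ^{p-1} f`
  have e : ∀ ρ, ρ ^ (p - 1) * Dz₁ f ρ = ρ ^ (p - 1) * (ρ * deriv f ρ) := fun ρ => by rw [Dz₁_apply]
  have hI : (∫ ρ in (0:ℝ)..R, ρ ^ (p - 1) * Dz₁ f ρ) = R ^ p * f R - p * ∫ ρ in (0:ℝ)..R, ρ ^ (p - 1) * f ρ := by
    -- derivative of `ρ ↦ ρ^p f ρ` on `ℝ`: handle `ρ ≤ 0` via vanishing of `f` near there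
    have hG : ∀ ρ, HasDerivAt (fun ρ : ℝ => ρ ^ p * f ρ) (p * (ρ ^ (p - 1) * f ρ) + ρ ^ (p - 1) * (ρ * deriv f ρ)) ρ := by
      intro ρ
      rcases lt_or_ge ρ a with hρ | hρ
      · have h0 : (fun ρ : ℝ => ρ ^ p * f ρ) =ᶠ[𝓝 ρ] fun _ => 0 :=
          Filter.eventuallyEq_of_mem (Iio_mem_nhds hρ) fun x hx => by simp [hfa x hx]
        have : p * (ρ ^ (p - 1) * f ρ) + ρ ^ (p - 1) * (ρ * deriv f ρ) = 0 := by simp [hfa ρ hρ, hfa' ρ hρ]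
        rw [this]; exact (hasDerivAt_const ρ (0:ℝ)).congr_of_eventuallyEq h0
      · have hρ0 : 0 < ρ := ha.trans_le hρ
        have h1 : HasDerivAt (fun ρ : ℝ => ρ ^ p) (p * ρ ^ (p - 1)) ρ := Real.hasDerivAt_rpow_const (Or.inl hρ0.ne')
        refine (h1.fun_mul (hfd ρ)).congr_deriv ?_
        have : ρ ^ p = ρ ^ (p - 1) * ρ := by
          rw [← Real.rpow_add_one hρ0.ne']; congr 1; ring
        rw [this]; ring
    have c1 : Continuous fun ρ : ℝ => p * (ρ ^ (p - 1) * f ρ) := continuous_const.mul (continuous_rpow_mul p hf.continuous ha hfa)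
    have c2 : Continuous fun ρ : ℝ => ρ ^ (p - 1) * (ρ * deriv f ρ) := by
      have := continuous_rpow_mul p (continuous_id.mul hfc') ha (fun x hx => by simp [hfa' x hx])
      exact this
    have hFTC := intervalIntegral.integral_eq_sub_of_hasDerivAt (a := 0) (b := R) (fun ρ _ => hG ρ) ((c1.add c2).intervalIntegrable _ _)
    rw [intervalIntegral.integral_add (c1.intervalIntegrable _ _) (c2.intervalIntegrable _ _), intervalIntegral.integral_const_mul] at hFTC
    simp only [Real.zero_rpow hp.ne', zero_mul, sub_zero] at hFTC
    rw [intervalIntegral.integral_congr (fun ρ _ => e ρ)]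
    linarith
  rw [hI, mul_sub, ← mul_assoc, ← Real.rpow_add hR, show -p + p = 0 by ring, Real.rpow_zero, one_mul]
  ring

end Elgindi

end Literature.Analysis.FluidPDE
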